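import Summits.Ventures.PercRepro.ProfilePointedCircuitClassesStarSharpD0T

/-!
# PercRepro — CASE D0 OF `StarNineSharp`, PART U: THE TARGET SETS OF THE `ef`-PLANE CLASS
(p5, gen 55; `proofs/P5-GM1.md` §82)

For the ON plane `H` through `e, f` with trace `T = H ∩ X` and `W = X ∖ H`, the targets available to the `ef`-plane
demands are indexed by
* the C-points of the trace, `Cset = {t ∈ T : ρ{e, f, t} = 3, ρ(X − t) = 4}` — each gives the ON set `{e, f, t} + b`
  (`card_cset_le_tcon`), and
* the pairs `G = {(z, w) ∈ T × W : ρ{e, f, z} = 3, X − z − w OFF}` — each gives the bi-basis `{z, w} + e + f`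
  whose pair `{z, w}` is never an ON demand (`not_on_demand_of_meets_H'`, F1″), `card_gset_le_tb4`.
The cut lemma `on_line_of_two_on_planes` (two ON sets of rank `≤ 3` with a rank-4 union force every rank-2 subset of
their intersection to be ON) is the engine of parts V and W.
-/

open scoped Matroid

namespace PercRepro.Cogirth

open Finset ThmH Skew Shadow Profile

open Classical

variable {α : Type} [DecidableEq α] {N : Matroid α} [N.Finite]

section StarSharpD0U

variable {b b' : α}

/-- **THE CUT LEMMA**: two ON sets `S₁, S₂ ⊆ E₇` (`ρ(S_i ∪ {b, b′}) = 4`) whose union has rank `4` force every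
rank-2 set `L ⊆ S₁ ∩ S₂` to be ON: `ρ(L ∪ {b, b′}) = 3` (submodularity in `N`). -/
theorem on_line_of_two_on_planes (h : SeriesPair N b b') (hR : rk N (gr N) = 5)
    {S₁ S₂ L : Finset α} (hS₁ : S₁ ⊆ ((gr N).erase b).erase b') (hS₂ : S₂ ⊆ ((gr N).erase b).erase b')
    (hon₁ : rk N (insert b (insert b' S₁)) = 4) (hon₂ : rk N (insert b (insert b' S₂)) = 4)
    (hU : rk N (S₁ ∪ S₂) = 4) (hL : L ⊆ S₁ ∩ S₂) (hL2 : rk N L = 2) :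
    rk N (insert b (insert b' L)) = 3 := by
  have h1 := rk_inter_bb'_le_three_of_two_on h hR hS₁ hS₂ hon₁ hon₂ hU
  have h2 : rk N (insert b (insert b' L)) ≤ rk N (insert b (insert b' (S₁ ∩ S₂))) :=
    rk_mono' (M := N) (insert_subset_insert _ (insert_subset_insert _ hL))
  have h3 := rk_insert_bb'_bounds h (S := L) (hL.trans (inter_subset_left.trans hS₁))
  omega

/-- Adding `b, b′` commutes with a spanning point: `ρ(S + w) = ρ(S)` gives `ρ(S + w + bb′) = ρ(S + bb′)`. -/
theorem rk_insert_bb'_insert_eq_of_rk_insert_eq {S : Finset α} {w : α} (hw : rk N (insert w S) = rk N S) :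
    rk N (insert b (insert b' (insert w S))) = rk N (insert b (insert b' S)) := by
  have := rk_insert_union_eq_of_rk_insert_eq (N := N) (S := S) (T := ({b, b'} : Finset α)) hw
  rwa [insert_union_bb'_eq', union_bb'_eq'] at this

/-- A point in the closure of `S` is in the closure of every superset: `ρ(S + w) = ρ(S)`, `S ⊆ S′` give
`ρ(S′ + w) = ρ(S′)`. -/
theorem rk_insert_eq_of_rk_insert_eq_subset' {S S' : Finset α} {w : α} (hSS : S ⊆ S')
    (hw : rk N (insert w S) = rk N S) : rk N (insert w S') = rk N S' := by
  have := rk_insert_union_eq_of_rk_insert_eq (N := N) (S := S) (T := S') hw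
  rwa [union_eq_right.2 hSS] at this

/-- **THE PAIR `{z, w}` OF A TRACE POINT `z` AND A POINT `w ∉ H` IS NEVER AN ON DEMAND** (no ON line through `e`):
an ON rank-3 set `{e, z, w}` would meet the ON plane `H` in the line `{e, z}` with a rank-4 union (F1″). -/
theorem not_on_demand_of_meets_H' (h : SeriesPair N b b') (hR : rk N (gr N) = 5)
    {e f : α}
    (hnle : ∀ S : Finset α, S ⊆ ((gr N).erase b).erase b' → e ∈ S → rk N (insert b (insert b' S)) ≤ 3 → rk N S ≤ 1)
    (he : e ∈ gr N) (heb : e ≠ b) (heb' : e ≠ b')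
    (he1 : ∀ y ∈ ((((gr N).erase b).erase b').erase f).erase e, rk N {e, y} = 2)
    {H : Finset α} (hH : H ⊆ ((gr N).erase b).erase b') (heH : e ∈ H)
    (hHon : rk N (insert b (insert b' H)) = 4)
    (hHfl : ∀ z ∈ ((gr N).erase b).erase b', z ∉ H → rk N (insert z H) = 4)
    {z w : α} (hz : z ∈ ((((gr N).erase b).erase b').erase f).erase e) (hzH : z ∈ H)
    (hw : w ∈ ((((gr N).erase b).erase b').erase f).erase e) (hwH : w ∉ H) :
    ¬ (insert b (insert e {z, w}) ∈ biIndepSets N 4 ∧ rk N (insert b (insert b' (insert e {z, w}))) = 4) := by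
  rintro ⟨-, hon⟩
  have hXE : ((((gr N).erase b).erase b').erase f).erase e ⊆ ((gr N).erase b).erase b' :=
    (erase_subset _ _).trans (erase_subset _ _)
  have heE : e ∈ ((gr N).erase b).erase b' := mem_erase.2 ⟨heb', mem_erase.2 ⟨heb, he⟩⟩
  have hS : insert e ({z, w} : Finset α) ⊆ ((gr N).erase b).erase b' := by
    intro x hx
    simp only [mem_insert, mem_singleton] at hx
    rcases hx with rfl | rfl | rfl
    · exact heE
    · exact hXE hz
    · exact hXE hw
  have hU : rk N (insert e ({z, w} : Finset α) ∪ H) = 4 := by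
    have e1 : insert e ({z, w} : Finset α) ∪ H = insert w H := by
      ext x
      simp only [mem_union, mem_insert, mem_singleton]
      constructor
      · rintro ((rfl | rfl | rfl) | hx)
        · exact Or.inr heH
        · exact Or.inr hzH
        · exact Or.inl rfl
        · exact Or.inr hx
      · rintro (rfl | hx)
        · exact Or.inl (Or.inr (Or.inr rfl))
        · exact Or.inr hx
    rw [e1]
    exact hHfl w (hXE hw) hwH
  have h1 := rk_inter_le_one_of_two_on_e h hR hnle hS hH (mem_insert_self _ _) heH hon hHon hU
  have h2 : ({e, z} : Finset α) ⊆ insert e ({z, w} : Finset α) ∩ H := by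
    intro x hx
    simp only [mem_insert, mem_singleton] at hx
    rcases hx with rfl | rfl
    · exact mem_inter.2 ⟨mem_insert_self _ _, heH⟩
    · exact mem_inter.2 ⟨mem_insert_of_mem (mem_insert_self _ _), hzH⟩
  have h3 := rk_mono' (M := N) h2
  rw [he1 z hz] at h3
  omega

/-- **THE C-POINTS OF THE TRACE INJECT INTO THE ON TARGETS `{e, f, t} + b`**. -/
theorem card_cset_le_tcon (h : SeriesPair N b b') (hn : (gr N).card = 9)
    {e f : α} (he : e ∈ gr N) (hf : f ∈ gr N) (hef : e ≠ f) (heb : e ≠ b) (heb' : e ≠ b') (hfb : f ≠ b) (hfb' : f ≠ b')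
    {H : Finset α} (hH : H ⊆ ((gr N).erase b).erase b') (heH : e ∈ H) (hfH : f ∈ H) (hH3 : rk N H = 3)
    (hHon : rk N (insert b (insert b' H)) = 4) :
    (((H.erase e).erase f).filter (fun t => rk N {e, f, t} = 3 ∧
        rk N ((((((gr N).erase b).erase b').erase f).erase e).erase t) = 4)).card ≤
      ((biIndepSets N 4).filter (fun W => (f ∈ W ∧ b' ∉ W) ∧
        (e ∈ W ∧ b ∈ W ∧ ¬ (gr N \ W).erase b' ∈ biIndepSets N 4))).card := by
  have hbb' : b ≠ b' := h.2.2.1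
  have hTX : (H.erase e).erase f ⊆ ((((gr N).erase b).erase b').erase f).erase e := by
    intro t ht
    have htf : t ≠ f := (mem_erase.1 ht).1
    have hte : t ≠ e := (mem_erase.1 (mem_erase.1 ht).2).1
    have htH : t ∈ H := mem_of_mem_erase (mem_of_mem_erase ht)
    exact mem_erase.2 ⟨hte, mem_erase.2 ⟨htf, hH htH⟩⟩
  apply card_le_card_of_injOn (fun t => insert b {e, f, t})
  · intro t ht
    simp only [mem_coe, mem_filter] at ht
    obtain ⟨htT, heft, ht4⟩ := ht
    have htX := hTX htT
    have htH : t ∈ H := mem_of_mem_erase (mem_of_mem_erase htT)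
    have hte : t ≠ e := (mem_erase.1 htX).1
    have htf : t ≠ f := (mem_erase.1 (mem_erase.1 htX).2).1
    have htE : t ∈ ((gr N).erase b).erase b' := hH htH
    have hS : ({e, f, t} : Finset α) ⊆ ((gr N).erase b).erase b' := by
      intro w hw; simp only [mem_insert, mem_singleton] at hw
      rcases hw with rfl | rfl | rfl
      · exact mem_erase.2 ⟨heb', mem_erase.2 ⟨heb, he⟩⟩
      · exact mem_erase.2 ⟨hfb', mem_erase.2 ⟨hfb, hf⟩⟩
      · exact htE
    have hSH : ({e, f, t} : Finset α) ⊆ H := by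
      intro w hw; simp only [mem_insert, mem_singleton] at hw
      rcases hw with rfl | rfl | rfl <;> assumption
    have hS3' : ({e, f, t} : Finset α).card = 3 := by
      rw [card_insert_of_notMem, card_pair htf.symm]
      simp only [mem_insert, mem_singleton, not_or]; exact ⟨hef, hte.symm⟩
    have hon : rk N (insert b (insert b' {e, f, t})) = 4 := rk_insert_bb'_eq_of_subset_H hSH heft hH3 hHon
    simp only [mem_coe, mem_filter]
    refine ⟨?_, ⟨mem_insert_of_mem (mem_insert_of_mem (mem_insert_self _ _)), ?_⟩,
      mem_insert_of_mem (mem_insert_self _ _), mem_insert_self _ _, ?_⟩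
    · rw [insert_b_mem_biIndepSets_iff h hn hS hS3', E7_sdiff_efx_eq]
      exact ⟨heft, ht4⟩
    · intro h'
      simp only [mem_insert, mem_singleton] at h'
      rcases h' with h2 | h2 | h2 | h2
      · exact hbb' h2.symm
      · exact heb' h2.symm
      · exact hfb' h2.symm
      · exact (mem_erase.1 htE).1 h2.symm
    · rw [off_image_efx_iff h hn he hf hef heb heb' hfb hfb' htX]
      rintro ⟨-, h5⟩
      omega
  · intro t₁ ht₁ t₂ ht₂ heq
    simp only [mem_coe, mem_filter] at ht₁ ht₂
    have heq' : insert b ({e, f, t₁} : Finset α) = insert b ({e, f, t₂} : Finset α) := heq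
    have h1 : t₁ ∈ insert b ({e, f, t₂} : Finset α) := by
      rw [← heq']; exact mem_insert_of_mem (mem_insert_of_mem (mem_insert_of_mem (mem_singleton_self _)))
    have ht₁X := hTX ht₁.1
    simp only [mem_insert, mem_singleton] at h1
    rcases h1 with h1 | h1 | h1 | h1
    · exact absurd h1 (mem_erase.1 (mem_erase.1 (mem_erase.1 (mem_erase.1 ht₁X).2).2).2).1
    · exact absurd h1 (mem_erase.1 ht₁X).1
    · exact absurd h1 (mem_erase.1 (mem_erase.1 ht₁X).2).1
    · exact h1


/-- **THE PAIRS `(z, w) ∈ T × W` WITH `ρ{e, f, z} = 3` AND `X − z − w` OFF INJECT INTO THE BI-BASES `{z, w} + e + f`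
WHOSE PAIR IS NOT AN ON DEMAND** (the target kind of R4a′ / R4c). -/
theorem card_gset_le_tb4 (h : SeriesPair N b b') (hn : (gr N).card = 9) (hR : rk N (gr N) = 5)
    {e f : α}
    (hnle : ∀ S : Finset α, S ⊆ ((gr N).erase b).erase b' → e ∈ S → rk N (insert b (insert b' S)) ≤ 3 → rk N S ≤ 1)
    (he : e ∈ gr N) (hf : f ∈ gr N) (hef : e ≠ f) (heb : e ≠ b) (heb' : e ≠ b') (hfb : f ≠ b) (hfb' : f ≠ b')
    (he1 : ∀ y ∈ ((((gr N).erase b).erase b').erase f).erase e, rk N {e, y} = 2)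
    {H : Finset α} (hH : H ⊆ ((gr N).erase b).erase b') (heH : e ∈ H) (hfH : f ∈ H) (hH3 : rk N H = 3)
    (hHon : rk N (insert b (insert b' H)) = 4)
    (hHfl : ∀ z ∈ ((gr N).erase b).erase b', z ∉ H → rk N (insert z H) = 4) :
    ((((H.erase e).erase f) ×ˢ (((((gr N).erase b).erase b').erase f).erase e \ H)).filter
        (fun p => rk N {e, f, p.1} = 3 ∧
          rk N (insert b (insert b' (((((gr N).erase b).erase b').erase f).erase e \ {p.1, p.2}))) = 5)).card ≤
      ((biIndepSets N 4).filter (fun B => ((f ∈ B ∧ b' ∉ B) ∧ (e ∈ B ∧ b ∉ B)) ∧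
        ¬ (insert b (B.erase f) ∈ biIndepSets N 4 ∧ rk N (insert b (insert b' (B.erase f))) = 4))).card := by
  have hXE : ((((gr N).erase b).erase b').erase f).erase e ⊆ ((gr N).erase b).erase b' :=
    (erase_subset _ _).trans (erase_subset _ _)
  have hE7g : ((gr N).erase b).erase b' ⊆ gr N := (erase_subset _ _).trans (erase_subset _ _)
  have heE : e ∈ ((gr N).erase b).erase b' := mem_erase.2 ⟨heb', mem_erase.2 ⟨heb, he⟩⟩
  have hfE : f ∈ ((gr N).erase b).erase b' := mem_erase.2 ⟨hfb', mem_erase.2 ⟨hfb, hf⟩⟩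
  have hTX : (H.erase e).erase f ⊆ ((((gr N).erase b).erase b').erase f).erase e := by
    intro t ht
    have htf : t ≠ f := (mem_erase.1 ht).1
    have hte : t ≠ e := (mem_erase.1 (mem_erase.1 ht).2).1
    have htH : t ∈ H := mem_of_mem_erase (mem_of_mem_erase ht)
    exact mem_erase.2 ⟨hte, mem_erase.2 ⟨htf, hH htH⟩⟩
  apply card_le_card_of_injOn (fun p => insert f (insert e {p.1, p.2}))
  · rintro ⟨z, w⟩ hp
    simp only [mem_coe, mem_filter, mem_product] at hp
    obtain ⟨⟨hzT, hwW⟩, hefz, hoff⟩ := hp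
    have hzX := hTX hzT
    have hzH : z ∈ H := mem_of_mem_erase (mem_of_mem_erase hzT)
    have hwX : w ∈ ((((gr N).erase b).erase b').erase f).erase e := (mem_sdiff.1 hwW).1
    have hwH : w ∉ H := (mem_sdiff.1 hwW).2
    have hze : z ≠ e := (mem_erase.1 hzX).1
    have hzf : z ≠ f := (mem_erase.1 (mem_erase.1 hzX).2).1
    have hwe : w ≠ e := (mem_erase.1 hwX).1
    have hwf : w ≠ f := (mem_erase.1 (mem_erase.1 hwX).2).1
    have hzw : z ≠ w := fun h' => hwH (h' ▸ hzH)
    have hzE := hXE hzX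
    have hwE := hXE hwX
    have hB : insert f (insert e ({z, w} : Finset α)) ⊆ ((gr N).erase b).erase b' := by
      intro x hx; simp only [mem_insert, mem_singleton] at hx
      rcases hx with rfl | rfl | rfl | rfl
      · exact hfE
      · exact heE
      · exact hzE
      · exact hwE
    have hB4 : (insert f (insert e ({z, w} : Finset α))).card = 4 := by
      rw [card_insert_of_notMem, card_insert_of_notMem, card_pair hzw]
      · simp only [mem_insert, mem_singleton, not_or]; exact ⟨hze.symm, hwe.symm⟩
      · simp only [mem_insert, mem_singleton, not_or]; exact ⟨hef.symm, hzf.symm, hwf.symm⟩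
    have hBr : rk N (insert f (insert e ({z, w} : Finset α))) = 4 := by
      rw [insert_f_insert_e_pair_eq]
      have hS : ({e, f, z} : Finset α) ⊆ H := by
        intro x hx; simp only [mem_insert, mem_singleton] at hx
        rcases hx with rfl | rfl | rfl <;> assumption
      have := rk_insert_eq_add_one_of_subset_flat (N := N) (H := H) (S := ({e, f, z} : Finset α)) (z := w)
        (hE7g hwE) (hH.trans hE7g) hS (by rw [hHfl w hwE hwH, hH3])
      rw [this, hefz]
    have hBmem : insert f (insert e ({z, w} : Finset α)) ∈ biIndepSets N 4 := by
      rw [mem_biIndepSets_iff_of_subset_E7 h hn hB hB4, E7_sdiff_insert_ef_eq]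
      exact ⟨hBr, hoff⟩
    have hBerase : (insert f (insert e ({z, w} : Finset α))).erase f = insert e {z, w} := by
      rw [erase_insert]
      simp only [mem_insert, mem_singleton, not_or]; exact ⟨hef.symm, hzf.symm, hwf.symm⟩
    simp only [mem_coe, mem_filter]
    refine ⟨hBmem, ⟨⟨mem_insert_self _ _, ?_⟩, mem_insert_of_mem (mem_insert_self _ _), ?_⟩, ?_⟩
    · intro h'; simp only [mem_insert, mem_singleton] at h'
      rcases h' with h2 | h2 | h2 | h2
      · exact hfb' h2.symm
      · exact heb' h2.symm
      · exact (mem_erase.1 hzE).1 h2.symm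
      · exact (mem_erase.1 hwE).1 h2.symm
    · intro h'; simp only [mem_insert, mem_singleton] at h'
      rcases h' with h2 | h2 | h2 | h2
      · exact hfb h2.symm
      · exact heb h2.symm
      · exact (mem_erase.1 (mem_erase.1 hzE).2).1 h2.symm
      · exact (mem_erase.1 (mem_erase.1 hwE).2).1 h2.symm
    · rw [hBerase]
      exact not_on_demand_of_meets_H' h hR hnle he heb heb' he1 hH heH hHon hHfl hzX hzH hwX hwH
  · rintro ⟨z₁, w₁⟩ hp₁ ⟨z₂, w₂⟩ hp₂ heq
    simp only [mem_coe, mem_filter, mem_product] at hp₁ hp₂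
    have heq' : insert f (insert e ({z₁, w₁} : Finset α)) = insert f (insert e ({z₂, w₂} : Finset α)) := heq
    have hz₁X := hTX hp₁.1.1
    have hz₂X := hTX hp₂.1.1
    have hz₁H : z₁ ∈ H := mem_of_mem_erase (mem_of_mem_erase hp₁.1.1)
    have hz₂H : z₂ ∈ H := mem_of_mem_erase (mem_of_mem_erase hp₂.1.1)
    have hw₁X : w₁ ∈ ((((gr N).erase b).erase b').erase f).erase e := (mem_sdiff.1 hp₁.1.2).1
    have hw₁H : w₁ ∉ H := (mem_sdiff.1 hp₁.1.2).2
    have hw₂H : w₂ ∉ H := (mem_sdiff.1 hp₂.1.2).2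
    have hz₁ : z₁ ∈ insert f (insert e ({z₂, w₂} : Finset α)) := by
      rw [← heq']; exact mem_insert_of_mem (mem_insert_of_mem (mem_insert_self _ _))
    have hw₁ : w₁ ∈ insert f (insert e ({z₂, w₂} : Finset α)) := by
      rw [← heq']; exact mem_insert_of_mem (mem_insert_of_mem (mem_insert_of_mem (mem_singleton_self _)))
    simp only [mem_insert, mem_singleton] at hz₁ hw₁
    have hzz : z₁ = z₂ := by
      rcases hz₁ with h1 | h1 | h1 | h1
      · exact absurd h1 (mem_erase.1 (mem_erase.1 hz₁X).2).1
      · exact absurd h1 (mem_erase.1 hz₁X).1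
      · exact h1
      · exact absurd (h1 ▸ hz₁H) hw₂H
    have hww : w₁ = w₂ := by
      rcases hw₁ with h1 | h1 | h1 | h1
      · exact absurd h1 (mem_erase.1 (mem_erase.1 hw₁X).2).1
      · exact absurd h1 (mem_erase.1 hw₁X).1
      · exact absurd (h1 ▸ hz₂H) hw₁H
      · exact h1
    rw [hzz, hww]

end StarSharpD0U

end PercRepro.Cogirth
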